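import Literature.NumberTheory.Rogawski1990.LocalTransferSecondClassDescentCM       -- ★ p842329 A-p17 (g21): `exists_isLocallyConstant_descent_secondClass` = `hD′` at `C′ := Z(ε′)` (S1)
import Literature.NumberTheory.Rogawski1990.FinExplicitTransferFactorTorusDockSplit   -- ★ `isConj_endoGL_of_frames` (the norm-pair transport `ι(↑t) ∼ ι(τ t)`)
import HarnessLib

/-!
# DESCENT AT THE COMPACT DOCK, READ AT THE TORUS — the binder `hD0′` of ★ `exists_nhds_finsum_side_eq_zero_of_compact_dock` (S2, Rogawski 1990 Prop. 8.2.1 (c))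
# at the concrete dock `C′ := Z_{G′_v}(ε′)`, transported from the central point `ε♭ = τ(b₀)` by the torus transport `τ`

Topic `NumberTheory/Rogawski1990`; namespace `Literature.NumberTheory.Rogawski1990`.  ONE THEOREM (no definition, no instance, no notation, no named fact,
no `sorry`).  Cell `pub/hodgecm-mathlib` (D-0151), crux H413 = stmt-HodgeConjecture-24833, floor-2 line «N6nsGerm» (`Cruxes/H413/Lines/F0_P3a_N6nsGerm.lean`,
stub `stub_N6nsS2`); LEAD F0P3a-plan (g9) WORD T8-152 «S2 residue `hD0′` → p08 (g14)»; seat F0P3a-p08 (g14).  Consumer: the S2 `hI0` assembly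
(`hI0 :=` ★ `exists_nhds_finsum_side_eq_zero_of_compact_dock … hD0′ hΔ0`, F0P3-p01 (g13) p842308) behind ★ A-p19 (g22)'s S2 DRESS
`exists_nhds_stableOrbitalIntegralRel_eq_of_torus_singular_of_frame` (p842316).  HONEST LABEL: HC_CM is proved only modulo the printed citations (2 remaining
named inputs hLiu418, h413) until rung 0 closes; this file is unconditional local harmonic analysis (a transport of ★ A-p17 (g21)'s S1 descent).

THE MATHEMATICS.  `ε_H = (A_{a,b}, a) ∈ H_v` is `H`-regular and `G`-singular; `t` runs over the torus `T = Z_{H_v}(ε_H)` near the base point `b₀ = ⟨ε_H, _⟩`.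
The torus transport `τ : T → H_v` (★ `exists_torusTransport_frame`, A-p19) exchanges the `b`-eigenvalue of `t₁` with the `U(1)`-coordinate: `ι(↑t)` and
`ι(τ t)` have the same three eigenlines, so `ι(↑t) ∼ ι(τ t)` in `GL₃` (★ `isConj_endoGL_of_frames`) and the matched classes of `↑t` and of `τ t` in `G′_v`
COINCIDE; and `τ(b₀) = ε♭ = (a·1₂, b)` is a CENTRAL point of `H_v` of the (S1) type (`b ≠ a`).  The S2 bad side at `t` is the S1 bad side at `τ t`:
`Q′ t γ′ :↔ IsLocalGRegular (τ t) ∧ ∃ x B, (x γ′ x⁻¹)·P′ = P′·(B ⊕ᶠ (τ t)₂)` for the bad frame `P′` at `ε♭` (second class `ε′`, `ε′ P′ = P′ (a·1₂ ⊕ᶠ b)`,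
`Z(ε′) ≅ U(2)_an × L_w¹` COMPACT).  Hence Harish-Chandra descent at the compact dock `C′ := Z(ε′)` for `γ_H` near `ε♭` (★ A-p17
`exists_isLocallyConstant_descent_secondClass`: every `Q′`-framed match of a `G`-regular `γ_H` near `ε♭` has orbital integral `Φ^{C′}(⟦m⟧, ψ_ε; m′)` at a
point `m` of any prescribed `B′ ∈ 𝓝 ε′`, `ψ_ε` locally constant on `C′`) transports VERBATIM to `t` near `b₀` along the continuous `τ` (`τ⁻¹(V) ∈ 𝓝 b₀`).

* **`exists_isLocallyConstant_descent_secondClass_torus`** — conclusion = ★ p842308's binder `hD0′` VERBATIM at `C′ := ↥Z(ε′)`, `εC := ⟨ε′, _⟩`,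
  `b₀ := ⟨ε_H, _⟩`, `Q′ :=` A-p19's instantiated bad side; binders = ★ A-p17's head read at `ε♭ = τ(b₀)` (`a := γ(ε_H)`) + the (T) transport clauses
  `hτc hτ₀ hεf₁ hεfu P ht1 hτ1 hτ2` of ★ `exists_torusTransport_frame` VERBATIM.

## References
* [Rogawski1990] J. D. Rogawski, *Automorphic Representations of Unitary Groups in Three Variables*, Ann. of Math. Stud. 123 (1990): §8.2 Prop. 8.2.1 (c) pp. 113–115,
  (a)(d) p. 112; §4.8 Case (a) p. 53; §4.3 (4.3.1) p. 43.
* [LanglandsShelstad1990Descent] R. P. Langlands, D. Shelstad, *Descent for transfer factors*, The Grothendieck Festschrift II (1990): Thm. 2.3.A, §2.4.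
* [HarishChandra1970] Harish-Chandra (van Dijk), *Harmonic Analysis on Reductive p-adic Groups*, LNM 162 (1970), Part I §3 Lemmas 19–21.
-/

set_option autoImplicit false

noncomputable section

open Set Filter Topology MeasureTheory Measure NumberField IsDedekindDomain Matrix
open scoped MatrixGroups

namespace Literature.NumberTheory.Rogawski1990

open Literature.NumberTheory.Automorphic Literature.NumberTheory.Automorphic.UnitaryGroup Literature.NumberTheory.GaloisRepresentations

section TorusCompactDock

variable (L : Type) [Field L] [NumberField L] [IsCMField L] (H' : Matrix (Fin 3) (Fin 3) L) (v : HeightOneSpectrum (𝓞 ↥(maximalRealSubfield L)))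

variable [MeasurableSpace ((cmDatum L 3 H').Local v)] [BorelSpace ((cmDatum L 3 H').Local v)]
  [iG : ∀ γ : ((cmDatum L 3 H').Local v), MeasurableSpace (((cmDatum L 3 H').Local v) ⧸ Subgroup.centralizer ({γ} : Set ((cmDatum L 3 H').Local v)))]
  [bG : ∀ γ : ((cmDatum L 3 H').Local v), BorelSpace (((cmDatum L 3 H').Local v) ⧸ Subgroup.centralizer ({γ} : Set ((cmDatum L 3 H').Local v)))]

/-- **DESCENT AT THE COMPACT DOCK, READ AT THE TORUS (S2 `hD0′`).**  At the `H`-regular, `G`-singular point `ε_H = (A_{a,b}, a)`, with the torus transport `τ`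
(`τ(b₀) = ε♭ = (a·1₂, b)`, eigenframe `P`), the bad frame `P′` at `ε♭` (anisotropic first block `G₁′`) and the second-class point `ε′` on it
(`ε′ P′ = P′ (a·1₂ ⊕ᶠ b)`): for every `ψ ∈ C_c^∞(G′_v)` there is a LOCALLY CONSTANT `ψ_ε` on the compact dock `C′ := Z_{G′_v}(ε′)` such that, for every
`B′ ∈ 𝓝 ε′` in `C′`, for `t ∈ T` near `b₀` with `↑t` `G`-regular, every class `c` on the bad side `Q′ t` (`τ t` `G`-regular and `x·out c·x⁻¹` framed by `P′` with
`U(1)`-block `(τ t)₂`) matched with `↑t` has `Φ_G(c, ψ; m_G) = Φ^{C′}(⟦m⟧, ψ_ε; m′)` at some `m ∈ B′` with `P″ (out ⟦m⟧)`.  Proof: ★ A-p17's S1 descent at the central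
point `ε♭`, pulled back along the continuous `τ` (`τ⁻¹ V ∈ 𝓝 b₀`), the matching transported by `ι(↑t) ∼_{GL₃} ι(τ t)` (★ `isConj_endoGL_of_frames`).
Conclusion = ★ `exists_nhds_finsum_side_eq_zero_of_compact_dock`'s binder `hD0′` verbatim (`C′ := ↥Z(ε′)`, `εC := ⟨ε′, _⟩`, `b₀ := ⟨ε_H, _⟩`, A-p19's `Q′`).
[cite: Rogawski1990, §8.2 Prop. 8.2.1 (c) pp. 113–115, (a)(d) p. 112; §4.8 Case (a) p. 53] [cite: LanglandsShelstad1990Descent, Thm. 2.3.A, §2.4] [cite: HarishChandra1970, Part I §3 Lemmas 19–21] -/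
theorem exists_isLocallyConstant_descent_secondClass_torus
    (hH' : (H'.map (cmConjRingHom L))ᵀ = H') (hdet' : H'.det ≠ 0)
    (w : PlacesOver L v) (hw : IsCMField.complexConj L • w.1 = w.1)
    (νG : Measure ((cmDatum L 3 H').Local v)) [νG.IsHaarMeasure] [νG.IsMulRightInvariant]
    {mG : OrbitalMeasureFamily ((cmDatum L 3 H').Local v)}
    (hmG : mG.IsCanonical (fun γ : ((cmDatum L 3 H').Local v) => IsRegularElt (γ.val : GL (Fin 3) (LocalRing L v))) νG)
    (εH : ((cmDatum L 2 (Matrix.of fun i j : Fin 2 => if i.val + j.val + 1 = 2 then (1 : L) else 0)).Local v × (cmDatum L 1 (Matrix.of fun i j : Fin 1 => if i.val + j.val + 1 = 1 then (1 : L) else 0)).Local v))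
    -- (T) the torus transport and its eigenframe (the clauses of ★ `exists_torusTransport_frame` used here, VERBATIM)
    (εf : ((cmDatum L 2 (Matrix.of fun i j : Fin 2 => if i.val + j.val + 1 = 2 then (1 : L) else 0)).Local v × (cmDatum L 1 (Matrix.of fun i j : Fin 1 => if i.val + j.val + 1 = 1 then (1 : L) else 0)).Local v)) (τ : ↥(Subgroup.centralizer ({εH} : Set ((cmDatum L 2 (Matrix.of fun i j : Fin 2 => if i.val + j.val + 1 = 2 then (1 : L) else 0)).Local v × (cmDatum L 1 (Matrix.of fun i j : Fin 1 => if i.val + j.val + 1 = 1 then (1 : L) else 0)).Local v))) → ((cmDatum L 2 (Matrix.of fun i j : Fin 2 => if i.val + j.val + 1 = 2 then (1 : L) else 0)).Local v × (cmDatum L 1 (Matrix.of fun i j : Fin 1 => if i.val + j.val + 1 = 1 then (1 : L) else 0)).Local v)) (hτc : Continuous τ) (hτ₀ : τ ⟨εH, Subgroup.mem_centralizer_singleton_iff.2 rfl⟩ = εf)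
    (hεf₁ : (εf.1.val.val : Matrix (Fin 2) (Fin 2) (LocalRing L v)) = finGammaTwo L v εH • (1 : Matrix (Fin 2) (Fin 2) (LocalRing L v)))
    (hεfu : finGammaTwo L v εf ≠ finGammaTwo L v εH)
    (P : GL (Fin 2) (LocalRing L v))
    (ht1 : ∀ t : ↥(Subgroup.centralizer ({εH} : Set ((cmDatum L 2 (Matrix.of fun i j : Fin 2 => if i.val + j.val + 1 = 2 then (1 : L) else 0)).Local v × (cmDatum L 1 (Matrix.of fun i j : Fin 1 => if i.val + j.val + 1 = 1 then (1 : L) else 0)).Local v))), (t.1.1.val.val : Matrix (Fin 2) (Fin 2) (LocalRing L v)) * P.val = P.val * Matrix.diagonal ![(P⁻¹.val * t.1.1.val.val * P.val) 0 0, (P⁻¹.val * t.1.1.val.val * P.val) 1 1])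
    (hτ1 : ∀ t : ↥(Subgroup.centralizer ({εH} : Set ((cmDatum L 2 (Matrix.of fun i j : Fin 2 => if i.val + j.val + 1 = 2 then (1 : L) else 0)).Local v × (cmDatum L 1 (Matrix.of fun i j : Fin 1 => if i.val + j.val + 1 = 1 then (1 : L) else 0)).Local v))), ((τ t).1.val.val : Matrix (Fin 2) (Fin 2) (LocalRing L v)) * P.val = P.val * Matrix.diagonal ![(P⁻¹.val * t.1.1.val.val * P.val) 0 0, finGammaTwo L v t.1])
    (hτ2 : ∀ t : ↥(Subgroup.centralizer ({εH} : Set ((cmDatum L 2 (Matrix.of fun i j : Fin 2 => if i.val + j.val + 1 = 2 then (1 : L) else 0)).Local v × (cmDatum L 1 (Matrix.of fun i j : Fin 1 => if i.val + j.val + 1 = 1 then (1 : L) else 0)).Local v))), ((τ t).2.val.val : Matrix (Fin 1) (Fin 1) (LocalRing L v)) = ((P⁻¹.val * t.1.1.val.val * P.val) 1 1) • (1 : Matrix (Fin 1) (Fin 1) (LocalRing L v)))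
    -- the bad frame `P′` at `ε♭` (anisotropic first Gram block) and the second-class point `ε′` on it
    {P' : GL (Fin 3) (LocalRing L v)} {G₁' : Matrix (Fin 2) (Fin 2) (LocalRing L v)} {G₂' : Matrix (Fin 1) (Fin 1) (LocalRing L v)}
    (hP' : twistGram (conjLocal L (IsCMField.complexConj L) v) ((adelicForm L 3 H').map (adeleToLocal L v)) P'.val = finSum 2 1 G₁' G₂')
    (hanis' : ∀ x : Fin 2 → LocalRing L v, Literature.AlgebraicGeometry.ShimuraVarieties.hermForm (conjLocal L (IsCMField.complexConj L) v) G₁' x x = 0 → x = 0)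
    (ε' : (cmDatum L 3 H').Local v)
    (hε' : (ε'.val.val : Matrix (Fin 3) (Fin 3) (LocalRing L v)) * P'.val =
      P'.val * finSum 2 1 (finGammaTwo L v εH • (1 : Matrix (Fin 2) (Fin 2) (LocalRing L v))) (εf.2.val.val : Matrix (Fin 1) (Fin 1) (LocalRing L v)))
    -- the `C′`-side data at `C′ := Z(ε′)`
    [MeasurableSpace ↥(Subgroup.centralizer ({ε'} : Set ((cmDatum L 3 H').Local v)))]
    [BorelSpace ↥(Subgroup.centralizer ({ε'} : Set ((cmDatum L 3 H').Local v)))]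
    [LocallyCompactSpace ↥(Subgroup.centralizer ({ε'} : Set ((cmDatum L 3 H').Local v)))]
    [∀ m : ↥(Subgroup.centralizer ({ε'} : Set ((cmDatum L 3 H').Local v))),
      MeasurableSpace (↥(Subgroup.centralizer ({ε'} : Set ((cmDatum L 3 H').Local v))) ⧸
        Subgroup.centralizer ({m} : Set ↥(Subgroup.centralizer ({ε'} : Set ((cmDatum L 3 H').Local v)))))]
    [∀ m : ↥(Subgroup.centralizer ({ε'} : Set ((cmDatum L 3 H').Local v))),
      BorelSpace (↥(Subgroup.centralizer ({ε'} : Set ((cmDatum L 3 H').Local v))) ⧸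
        Subgroup.centralizer ({m} : Set ↥(Subgroup.centralizer ({ε'} : Set ((cmDatum L 3 H').Local v)))))]
    (ν' : Measure ↥(Subgroup.centralizer ({ε'} : Set ((cmDatum L 3 H').Local v)))) [ν'.IsHaarMeasure] [ν'.IsMulRightInvariant]
    (P'' : ↥(Subgroup.centralizer ({ε'} : Set ((cmDatum L 3 H').Local v))) → Prop)
    (hP'' : ∀ m : ↥(Subgroup.centralizer ({ε'} : Set ((cmDatum L 3 H').Local v))), IsRegularElt ((m.1.val : GL (Fin 3) (LocalRing L v))) → P'' m)
    {m' : OrbitalMeasureFamily ↥(Subgroup.centralizer ({ε'} : Set ((cmDatum L 3 H').Local v)))} (hm' : m'.IsCanonical P'' ν') :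
    ∀ ψ : ((cmDatum L 3 H').Local v) → ℂ, IsLocSmooth ψ →
      ∃ ψε : ↥(Subgroup.centralizer ({ε'} : Set ((cmDatum L 3 H').Local v))) → ℂ, IsLocallyConstant ψε ∧
        ∀ B' ∈ 𝓝 (⟨ε', Subgroup.mem_centralizer_singleton_iff.2 rfl⟩ : ↥(Subgroup.centralizer ({ε'} : Set ((cmDatum L 3 H').Local v)))),
          ∃ V ∈ 𝓝 (⟨εH, Subgroup.mem_centralizer_singleton_iff.2 rfl⟩ : ↥(Subgroup.centralizer ({εH} : Set ((cmDatum L 2 (Matrix.of fun i j : Fin 2 => if i.val + j.val + 1 = 2 then (1 : L) else 0)).Local v × (cmDatum L 1 (Matrix.of fun i j : Fin 1 => if i.val + j.val + 1 = 1 then (1 : L) else 0)).Local v)))),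
            ∀ t ∈ V, IsLocalGRegular L v (t : ((cmDatum L 2 (Matrix.of fun i j : Fin 2 => if i.val + j.val + 1 = 2 then (1 : L) else 0)).Local v × (cmDatum L 1 (Matrix.of fun i j : Fin 1 => if i.val + j.val + 1 = 1 then (1 : L) else 0)).Local v)) →
              ∀ c : ConjClasses ((cmDatum L 3 H').Local v),
                (IsLocalGRegular L v (τ t) ∧ ∃ x : ((cmDatum L 3 H').Local v), ∃ B : Matrix (Fin 2) (Fin 2) (LocalRing L v),
                  ((x * Quotient.out c * x⁻¹).val.val : Matrix (Fin 3) (Fin 3) (LocalRing L v)) * P'.val = P'.val * finSum 2 1 B (((τ t).2.val.val : Matrix (Fin 1) (Fin 1) (LocalRing L v)))) →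
                IsLocalNormPair L H' v (t : ((cmDatum L 2 (Matrix.of fun i j : Fin 2 => if i.val + j.val + 1 = 2 then (1 : L) else 0)).Local v × (cmDatum L 1 (Matrix.of fun i j : Fin 1 => if i.val + j.val + 1 = 1 then (1 : L) else 0)).Local v)) (Quotient.out c) →
                  ∃ m ∈ B', P'' (Quotient.out (ConjClasses.mk m)) ∧ classOrbitalIntegral mG ψ c = classOrbitalIntegral m' ψε (ConjClasses.mk m) := by
  intro ψ hψ
  -- `γ(ε♭) ≠ γ(ε_H)` read on the `U(1)`-entry of `ε♭`
  have hεfu' : (εf.2.val.val : Matrix (Fin 1) (Fin 1) (LocalRing L v)) 0 0 ≠ finGammaTwo L v εH := hεfu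
  -- ★ A-p17's S1 descent at the central point `ε♭ = τ(b₀)`
  obtain ⟨ψε, hψε, hD⟩ := exists_isLocallyConstant_descent_secondClass L H' v hH' hdet' w hw νG hmG εf (finGammaTwo L v εH) hεf₁ hεfu'
    hP' hanis' ε' hε' ν' P'' hP'' hm' ψ hψ
  refine ⟨ψε, hψε, fun B' hB' => ?_⟩
  obtain ⟨V₁, hV₁, hV₁D⟩ := hD B' hB'
  -- pull `V₁ ∈ 𝓝 ε♭` back along the continuous torus transport `τ` (`τ b₀ = ε♭`)
  have hV : τ ⁻¹' V₁ ∈ 𝓝 (⟨εH, Subgroup.mem_centralizer_singleton_iff.2 rfl⟩ : ↥(Subgroup.centralizer ({εH} : Set ((cmDatum L 2 (Matrix.of fun i j : Fin 2 => if i.val + j.val + 1 = 2 then (1 : L) else 0)).Local v × (cmDatum L 1 (Matrix.of fun i j : Fin 1 => if i.val + j.val + 1 = 1 then (1 : L) else 0)).Local v)))) :=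
    hτc.continuousAt.preimage_mem_nhds (by rw [hτ₀]; exact hV₁)
  refine ⟨τ ⁻¹' V₁, hV, ?_⟩
  rintro t ht - c ⟨hτreg, x, B, hxP⟩ hpair
  -- `ι(↑t) ∼ ι(τ t)` in `GL₃`: the matching transports from `↑t` to `τ t`
  have key : IsConj ((endoEmbLocal L v (t : ((cmDatum L 2 (Matrix.of fun i j : Fin 2 => if i.val + j.val + 1 = 2 then (1 : L) else 0)).Local v × (cmDatum L 1 (Matrix.of fun i j : Fin 1 => if i.val + j.val + 1 = 1 then (1 : L) else 0)).Local v))).val : GL (Fin 3) (LocalRing L v)) ((endoEmbLocal L v (τ t)).val : GL (Fin 3) (LocalRing L v)) := by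
    rw [coe_endoEmbLocal, coe_endoEmbLocal]
    exact isConj_endoGL_of_frames P _ _ _ _ (ht1 t) rfl (hτ1 t) (by simp [hτ2 t])
  have hpair' : IsLocalNormPair L H' v (τ t) (Quotient.out c) := key.symm.trans hpair
  exact hV₁D (τ t) ht hτreg c ⟨x, B, hxP⟩ hpair'

end TorusCompactDock

end Literature.NumberTheory.Rogawski1990

end
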